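import Summits.MatrixMultiplication.MatrixMultiplication.Theses.ConeDesigns

/-!
# `ConeDesigns.ConeCriterion` — the exact criterion for cone STPP designs

Item `stmt-MatrixMultiplication-9765` (support, route `ConeDesigns`, card P1).

For a prime `q ≥ 3` and nonzero vectors `a i, b i, c i ∈ (ZMod q)^n`, the cone family of punctured
lines `A i = F_q^× • a i`, `B i = F_q^× • b i`, `C i = F_q^× • c i` has the simultaneous triple product
property `IsSTPP` (Cohn–Kleinberg–Szegedy–Umans 2005, Def. 5.1, additive form) iff

* (i) every triangle `(a i, b i, c i)` is linearly independent, and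
* (ii) for all `(i, j, k)` not all equal, no nowhere-zero `l ∈ F_q^6` has
  `l 0 • a i + l 1 • a k + l 2 • b j + l 3 • b i + l 4 • c k + l 5 • c j = 0`.

Proof: an element of a punctured line is `t • v` with `t ≠ 0`, so the STPP equation
`(s' - s) + (t' - t) + (u' - u) = 0` with `s' = l₀ • a i`, `s = μ • a k`, `t' = l₂ • b j`, `t = ν • b i`,
`u' = l₄ • c k`, `u = ρ • c j` is literally the hexagon relation with `l = (l₀, -μ, l₂, -ν, l₄, -ρ)`;
on the diagonal `i = j = k` it reads `(l₀ - μ) • a + (l₂ - ν) • b + (l₄ - ρ) • c = 0`, and since for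
`q ≥ 3` every element of `ZMod q` is a difference of two nonzero elements, the diagonal instances of
STPP are exactly linear independence of the triangle. (`q ≥ 3` is used only for STPP ⇒ (i).)
-/

-- `Summit.<Summit>.<Problem>` is the tree's mandated summit-side namespace; for this
-- single-conjunct summit the two coincide, so the file silences `dupNamespace`.
set_option linter.dupNamespace false

namespace Summit.MatrixMultiplication.MatrixMultiplication.Theorems

open Literature.Computability.AlgebraicComplexity

/-- In `ZMod q` with `q ≥ 3`, every element is a difference `l - m` of two nonzero elements. -/
theorem exists_sub_eq_of_three_le {q : ℕ} [NeZero q] (hq : 3 ≤ q) (x : ZMod q) :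
    ∃ l m : ZMod q, l ≠ 0 ∧ m ≠ 0 ∧ l - m = x := by
  have hcard : ({0, x} : Finset (ZMod q)).card < (Finset.univ : Finset (ZMod q)).card := by
    rw [Finset.card_univ, ZMod.card]
    exact lt_of_lt_of_le (lt_of_le_of_lt Finset.card_le_two (by norm_num)) hq
  obtain ⟨l, -, hl⟩ := Finset.exists_mem_notMem_of_card_lt_card hcard
  simp only [Finset.mem_insert, Finset.mem_singleton, not_or] at hl
  exact ⟨l, l - x, hl.1, sub_ne_zero.2 hl.2, by abel⟩

variable {q : ℕ} [Fact q.Prime] {n : ℕ}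

/-- Membership in the punctured line of a nonzero vector `v`: `x ∈ (F_q • v) ∖ {0}` iff
`x = t • v` for some scalar `t ≠ 0`. -/
theorem mem_puncturedLine_iff {v : Fin n → ZMod q} (hv : v ≠ 0) (x : Fin n → ZMod q) :
    x ∈ ((Finset.univ : Finset (ZMod q)).image (fun t => t • v)).erase 0 ↔
      ∃ t : ZMod q, t ≠ 0 ∧ t • v = x := by
  simp only [Finset.mem_erase, Finset.mem_image, Finset.mem_univ, true_and]
  constructor
  · rintro ⟨hx, t, rfl⟩
    refine ⟨t, ?_, rfl⟩
    rintro rfl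
    exact hx (zero_smul _ _)
  · rintro ⟨t, ht, rfl⟩
    exact ⟨smul_ne_zero ht hv, t, rfl⟩

/-- `t • v` lies on the punctured line of `v ≠ 0` whenever `t ≠ 0`. -/
theorem smul_mem_puncturedLine {v : Fin n → ZMod q} (hv : v ≠ 0) {t : ZMod q} (ht : t ≠ 0) :
    t • v ∈ ((Finset.univ : Finset (ZMod q)).image (fun t => t • v)).erase 0 :=
  (mem_puncturedLine_iff hv _).2 ⟨t, ht, rfl⟩

/-- A scalar is determined by its action on a nonzero vector: `m • v = l • v` with `v ≠ 0` forces
`l = m`. -/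
theorem eq_of_smul_eq_smul_of_ne_zero {v : Fin n → ZMod q} (hv : v ≠ 0) {l m : ZMod q}
    (h : m • v = l • v) : l = m := by
  have h' : (l - m) • v = 0 := by rw [sub_smul, h, sub_self]
  exact sub_eq_zero.1 ((smul_eq_zero.1 h').resolve_right hv)

/-- **Exact criterion for cone STPP designs** (item `stmt-MatrixMultiplication-9765`, route
`ConeDesigns`, support `ConeCriterion`, card P1): for a prime `q ≥ 3` and nonzero vectors
`a i, b i, c i ∈ (ZMod q)^n`, the family of punctured lines `(F_q^× a i, F_q^× b i, F_q^× c i)_i` is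
STPP iff (i) every triangle `![a i, b i, c i]` is linearly independent and (ii) for all `(i, j, k)`
not all equal no nowhere-zero `l : Fin 6 → ZMod q` satisfies
`l 0 • a i + l 1 • a k + l 2 • b j + l 3 • b i + l 4 • c k + l 5 • c j = 0`.
Substitution `s' = l 0 • a i`, `s = -(l 1) • a k`, `t' = l 2 • b j`, `t = -(l 3) • b i`,
`u' = l 4 • c k`, `u = -(l 5) • c j` in CKSU 2005 Def. 5.1; `q ≥ 3` enters only through
`exists_sub_eq_of_three_le` in STPP ⇒ (i). -/
theorem coneCriterion_proof :
    Summit.MatrixMultiplication.MatrixMultiplication.Theses.ConeDesigns.ConeCriterion := by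
  unfold Summit.MatrixMultiplication.MatrixMultiplication.Theses.ConeDesigns.ConeCriterion
  intro n q _ hq N a b c hnz
  haveI : NeZero q := ⟨(Fact.out : q.Prime).ne_zero⟩
  constructor
  · intro hS
    refine ⟨fun i => ?_, fun i j k hijk l hl hsum => ?_⟩
    · -- (i): the diagonal instances of STPP give linear independence of the triangle
      rw [Fintype.linearIndependent_iff]
      intro g hg
      rw [Fin.sum_univ_three] at hg
      simp only [Matrix.cons_val_zero, Matrix.cons_val_one, Matrix.cons_val] at hg
      obtain ⟨l₀, m₀, hl₀, hm₀, h₀⟩ := exists_sub_eq_of_three_le hq (g 0)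
      obtain ⟨l₁, m₁, hl₁, hm₁, h₁⟩ := exists_sub_eq_of_three_le hq (g 1)
      obtain ⟨l₂, m₂, hl₂, hm₂, h₂⟩ := exists_sub_eq_of_three_le hq (g 2)
      have key := hS i i i (m₀ • a i) (smul_mem_puncturedLine (hnz i).1 hm₀)
        (l₀ • a i) (smul_mem_puncturedLine (hnz i).1 hl₀)
        (m₁ • b i) (smul_mem_puncturedLine (hnz i).2.1 hm₁)
        (l₁ • b i) (smul_mem_puncturedLine (hnz i).2.1 hl₁)
        (m₂ • c i) (smul_mem_puncturedLine (hnz i).2.2 hm₂)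
        (l₂ • c i) (smul_mem_puncturedLine (hnz i).2.2 hl₂)
        (by rw [← sub_smul, ← sub_smul, ← sub_smul, h₀, h₁, h₂]; exact hg)
      obtain ⟨-, -, ha, hb, hc⟩ := key
      have e₀ : g 0 = 0 := by
        rw [← h₀, sub_eq_zero]; exact eq_of_smul_eq_smul_of_ne_zero (hnz i).1 ha
      have e₁ : g 1 = 0 := by
        rw [← h₁, sub_eq_zero]; exact eq_of_smul_eq_smul_of_ne_zero (hnz i).2.1 hb
      have e₂ : g 2 = 0 := by
        rw [← h₂, sub_eq_zero]; exact eq_of_smul_eq_smul_of_ne_zero (hnz i).2.2 hc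
      intro m
      fin_cases m
      · exact e₀
      · exact e₁
      · exact e₂
    · -- (ii): an off-diagonal nowhere-zero hexagon relation is an STPP violation
      have key := hS i j k ((-l 1) • a k) (smul_mem_puncturedLine (hnz k).1 (neg_ne_zero.2 (hl 1)))
        (l 0 • a i) (smul_mem_puncturedLine (hnz i).1 (hl 0))
        ((-l 3) • b i) (smul_mem_puncturedLine (hnz i).2.1 (neg_ne_zero.2 (hl 3)))
        (l 2 • b j) (smul_mem_puncturedLine (hnz j).2.1 (hl 2))
        ((-l 5) • c j) (smul_mem_puncturedLine (hnz j).2.2 (neg_ne_zero.2 (hl 5)))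
        (l 4 • c k) (smul_mem_puncturedLine (hnz k).2.2 (hl 4))
        (by rw [← hsum]; simp only [neg_smul, sub_neg_eq_add]; abel)
      exact hijk ⟨key.1, key.2.1⟩
  · rintro ⟨hLI, hHex⟩
    intro i j k s hs s' hs' t ht t' ht' u hu u' hu' hsum
    obtain ⟨μ, hμ, rfl⟩ := (mem_puncturedLine_iff (hnz k).1 s).1 hs
    obtain ⟨l₀, hl₀, rfl⟩ := (mem_puncturedLine_iff (hnz i).1 s').1 hs'
    obtain ⟨ν, hν, rfl⟩ := (mem_puncturedLine_iff (hnz i).2.1 t).1 ht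
    obtain ⟨l₂, hl₂, rfl⟩ := (mem_puncturedLine_iff (hnz j).2.1 t').1 ht'
    obtain ⟨ρ, hρ, rfl⟩ := (mem_puncturedLine_iff (hnz j).2.2 u).1 hu
    obtain ⟨l₄, hl₄, rfl⟩ := (mem_puncturedLine_iff (hnz k).2.2 u').1 hu'
    by_cases hijk : i = j ∧ j = k
    · -- diagonal: linear independence of the triangle forces equal scalars
      obtain ⟨rfl, rfl⟩ := hijk
      have hli := (Fintype.linearIndependent_iff.1 (hLI i)) ![l₀ - μ, l₂ - ν, l₄ - ρ]
        (by
          rw [Fin.sum_univ_three]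
          simp only [Matrix.cons_val_zero, Matrix.cons_val_one, Matrix.cons_val, sub_smul]
          exact hsum)
      have e₀ := hli 0
      have e₁ := hli 1
      have e₂ := hli 2
      simp only [Matrix.cons_val_zero, Matrix.cons_val_one, Matrix.cons_val, sub_eq_zero] at e₀ e₁ e₂
      exact ⟨rfl, rfl, by rw [e₀], by rw [e₁], by rw [e₂]⟩
    · -- off-diagonal: the STPP equation is a nowhere-zero hexagon relation, excluded by (ii)
      exfalso
      refine hHex i j k hijk ![l₀, -μ, l₂, -ν, l₄, -ρ] ?_ ?_
      · intro m
        fin_cases m <;> simp [hl₀, hμ, hl₂, hν, hl₄, hρ]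
      · rw [← hsum]
        simp only [Matrix.cons_val_zero, Matrix.cons_val_one, Matrix.cons_val, neg_smul]
        abel

end Summit.MatrixMultiplication.MatrixMultiplication.Theorems
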